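import Summits.Ventures.PercRepro0.Monotone

/-!
# Block L glue, kernel-checked: `θ_d(1) = 1` and the two forms of `p_c` (L0)

Cell pub-perc-repro0, seat p2.

* `θ_one`         : for `d ≥ 1`, `θ_d(1) = 1` (so `{p : θ_d(p) > 0}` is nonempty and `p_c(d)` is a genuine infimum);
* `θ_eq_zero_of_lt`, `θ_pos_of_gt` : `θ_d = 0` on `[0, p_c)` and `> 0` on `(p_c, 1]` (`d ≥ 1`);
* `pc_eq_sSup`    : L0, `p_c(d) = sup {p : θ_d(p) = 0}` (`d ≥ 1`).
-/

open MeasureTheory ProbabilityTheory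

namespace Summit.Ventures.PercRepro0

variable {d : ℕ}

-- BEGIN BODY

/-! ### The all-open configuration -/

/-- In the all-open configuration, moving one coordinate by any integer amount is an open connection. -/
lemma conn_top_update (x : Vertex d) (i : Fin d) (k : ℤ) :
    Conn (fun _ : Bond d => true) x (Function.update x i (x i + k)) := by
  induction k with
  | zero =>
    have h : Function.update x i (x i + (0 : ℤ)) = x := by simp
    rw [h]
    exact Relation.ReflTransGen.refl
  | succ n ih =>
    refine ih.tail ⟨(Function.update x i (x i + n), i), rfl, Or.inl ⟨rfl, ?_⟩⟩
    simp only [Bond.tgt, Function.update_self, Function.update_idem]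
    ring_nf
  | pred n ih =>
    refine ih.tail ⟨(Function.update x i (x i + (-(n : ℤ) - 1)), i), rfl, Or.inr ⟨rfl, ?_⟩⟩
    simp only [Bond.tgt, Function.update_self, Function.update_idem]
    congr 1
    ring

/-- The vertex agreeing with `x` on the coordinates in `S` and vanishing elsewhere. -/
def truncV (S : Finset (Fin d)) (x : Vertex d) : Vertex d :=
  fun i => if i ∈ S then x i else 0

/-- In the all-open configuration every vertex is connected to the origin. -/
lemma conn_top (x : Vertex d) : Conn (fun _ : Bond d => true) 0 x := by
  classical
  have key : ∀ S : Finset (Fin d), Conn (fun _ : Bond d => true) 0 (truncV S x) := by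
    intro S
    induction S using Finset.induction_on with
    | empty =>
      have : truncV (∅ : Finset (Fin d)) x = 0 := by
        funext i; simp [truncV]
      rw [this]
      exact Relation.ReflTransGen.refl
    | insert i S hi ih =>
      have : truncV (insert i S) x = Function.update (truncV S x) i (truncV S x i + x i) := by
        funext j
        by_cases hj : j = i
        · subst hj; simp [truncV, hi]
        · simp [truncV, hj]
      rw [this]
      exact ih.trans (conn_top_update (truncV S x) i (x i))
  have : truncV Finset.univ x = x := by funext i; simp [truncV]
  rw [← this]
  exact key Finset.univ

/-- The cluster of the origin in the all-open configuration is everything. -/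
lemma cluster_top : cluster (fun _ : Bond d => true) = Set.univ :=
  Set.eq_univ_of_forall fun x => conn_top x

/-- `P_1` is the Dirac mass at the all-open configuration. -/
lemma percMeasure_one : percMeasure d 1 = Measure.dirac (fun _ : Bond d => true) := by
  unfold percMeasure
  simp only [bernoulliMeasure_one]
  refine (Measure.eq_infinitePi _ ?_).symm
  intro s t ht
  rw [Measure.dirac_apply' _ (MeasurableSet.pi s.countable_toSet fun i _ => ht i)]
  classical
  by_cases hmem : (fun _ : Bond d => true) ∈ Set.pi (↑s) t
  · rw [Set.indicator_of_mem hmem, Pi.one_apply]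
    symm
    refine Finset.prod_eq_one fun i hi => ?_
    rw [Measure.dirac_apply' _ (ht i), Set.indicator_of_mem (hmem i hi), Pi.one_apply]
  · rw [Set.indicator_of_notMem hmem]
    symm
    simp only [Set.mem_pi, Finset.mem_coe, not_forall] at hmem
    obtain ⟨i, hi, hfi⟩ := hmem
    refine Finset.prod_eq_zero hi ?_
    rw [Measure.dirac_apply' _ (ht i), Set.indicator_of_notMem hfi]

/-- `θ_d(1) = 1` for `d ≥ 1`: under `P_1` every bond is open and the cluster of the origin is all of
`ℤ^d`, which is infinite. -/
lemma θ_one (hd : 1 ≤ d) : θ d 1 = 1 := by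
  unfold θ
  rw [percMeasure_one, measureReal_def, Measure.dirac_apply, Set.indicator_of_mem]
  · simp
  · simp only [InfCluster, Set.mem_setOf_eq, cluster_top]
    haveI : Nonempty (Fin d) := ⟨⟨0, hd⟩⟩
    exact Set.infinite_univ

/-! ### `θ_d` below and above `p_c` -/

/-- `θ_d = 0` on `[0, p_c(d))`. -/
lemma θ_eq_zero_of_lt (d : ℕ) {p : unitInterval} (hp : (p : ℝ) < pc d) : θ d p = 0 := by
  by_contra h
  have hpos : 0 < θ d p := lt_of_le_of_ne (θ_nonneg d p) (Ne.symm h)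
  have hmem : (p : ℝ) ∈ posSet d := ⟨p.2, hpos⟩
  have : pc d ≤ p := csInf_le ⟨0, fun q hq => hq.1.1⟩ hmem
  linarith

/-- `θ_d > 0` on `(p_c(d), 1]` (for `d ≥ 1`). -/
lemma θ_pos_of_gt (hd : 1 ≤ d) {p : unitInterval} (hp : pc d < p) : 0 < θ d p := by
  have hne : (posSet d).Nonempty :=
    ⟨1, unitInterval.one_mem, by change 0 < θ d 1; rw [θ_one hd]; exact one_pos⟩
  obtain ⟨q, ⟨hq, hqpos⟩, hqp⟩ := exists_lt_of_csInf_lt hne hp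
  exact lt_of_lt_of_le hqpos (θ_mono d (Subtype.mk_le_mk.2 hqp.le))

/-- L0 · PC-FORMS: `p_c(d) = sup {p ∈ [0,1] : θ_d(p) = 0}` (for `d ≥ 1`). -/
theorem pc_eq_sSup (hd : 1 ≤ d) :
    pc d = sSup {p : ℝ | ∃ hp : p ∈ unitInterval, θ d ⟨p, hp⟩ = 0} := by
  have hbdd : BddAbove {p : ℝ | ∃ hp : p ∈ unitInterval, θ d ⟨p, hp⟩ = 0} :=
    ⟨1, fun q hq => hq.1.2⟩
  have hne : {p : ℝ | ∃ hp : p ∈ unitInterval, θ d ⟨p, hp⟩ = 0}.Nonempty :=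
    ⟨0, unitInterval.zero_mem, θ_zero d⟩
  apply le_antisymm
  · -- every p with θ p > 0 bounds the zero set from above
    by_contra hlt
    push Not at hlt
    obtain ⟨r, hr1, hr2⟩ := exists_between hlt
    have h0le : (0 : ℝ) ≤ sSup {p : ℝ | ∃ hp : p ∈ unitInterval, θ d ⟨p, hp⟩ = 0} :=
      le_csSup hbdd ⟨unitInterval.zero_mem, θ_zero d⟩
    have hr_mem : r ∈ unitInterval := ⟨h0le.trans hr1.le, hr2.le.trans (pc_mem d).2⟩
    have h0 : θ d ⟨r, hr_mem⟩ = 0 := θ_eq_zero_of_lt d hr2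
    have : r ≤ sSup {p : ℝ | ∃ hp : p ∈ unitInterval, θ d ⟨p, hp⟩ = 0} :=
      le_csSup hbdd ⟨hr_mem, h0⟩
    linarith
  · refine csSup_le hne fun q ⟨hq, hq0⟩ => ?_
    by_contra hlt
    push Not at hlt
    have := θ_pos_of_gt hd (p := ⟨q, hq⟩) hlt
    rw [hq0] at this
    exact lt_irrefl _ this

-- END BODY

end Summit.Ventures.PercRepro0
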